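/-
Copyright (c) 2026 the pub-hodgecm-mathlib formalisation cell (harness21).  Prover seat hodgecm-mathlib-F0P3a-p06 (g18), 2026-09-02: «σ-DEPTH = CONDUCTOR-ORDER FILTRATION»
at a ramified CM place — the order-theoretic reading of ★ `RamifiedPlaceDifferent` (wild base layer of the (D-RAM) column; census F0P3a-p06 (g17) `DUNR-H2-CENSUS.md` §4).
-/
import Literature.NumberTheory.Automorphic.RamifiedPlaceDifferent   -- ★ p850872: `valued_galAdicCompletionMap_sub_self_toPlace_add_toPlace_mul`, `…_ne_zero`, `exists_different_of_ramified`, …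
import HarnessLib

/-!
# σ-DEPTH = CONDUCTOR-ORDER FILTRATION at a ramified CM place: `|σ_w x − x| ≤ exp(−2j)·|σ_w τ − τ| ⟺ x ∈ 𝒪_v + ϖ_v^j 𝒪_w` (any residue characteristic)
# (Serre, *Local Fields* IV §1; Neukirch I §12 (orders and conductors); Flicker 1998 Prop. 7 (the orders `R + π^j R_E`))

Topic `NumberTheory/Automorphic`; namespace `Literature.NumberTheory.Automorphic.UnitaryGroup`.  THEOREMS ONLY (no definition, no instance, no notation, no named fact,
no `sorry`; axioms ⊆ {propext, Classical.choice, Quot.sound}).  Cell `pub/hodgecm-mathlib` (D-0151), crux H413 = `stmt-HodgeConjecture-24833`; half A line LH4, DYADIC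
pay-down leaf `Cruxes/H413/Lines/F0_P3c_DyadicPaydown.lean`, organ (D-RAM) (PRINT by ruling D74′, scope audit LH4-plan (g5) b4c7662647f1db69 «COVERED at v ∣ 2»: this file is
BANKED base layer, consumers none live).  HONEST LABEL: HC_CM is proved only modulo the 7 printed citations (2 remaining named inputs: hLiu418 = stmt-HodgeConjecture-24832, h413 =
stmt-HodgeConjecture-24833) until rung 0 closes; unconditional local algebra, count-neutral.

SETTING (= ★ `RamifiedPlaceDifferent`): `L` CM, `w ∣ v` non-split with `e(w|v) ≠ 1`, `ι = toPlace v w`, `σ = σ_w`, `τ` a uniformiser of `L_w`, `D := |στ − τ|_w = exp(−d)` the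
different number (★ `exists_different_of_ramified`; `d = 1` iff tame).  The TAME order-index files read the conductor-`j` order `𝒪_v + ϖ_v^j 𝒪_w` σ-intrinsically as
`{x : σx ≡ x (𝔪_w^{2j+1})}` (★ `RamifiedQuadraticOrderUnitIndex`, `UnramifiedQuadraticOrderUnitIndex.map_sub_self_mem_pow_iff_exists_fixed`); THIS file gives the reading at
ANY ramified place: the σ-depth filtration of `L_w` has jumps only at `d + 2ℤ` and its `(d + 2j)`-th step on `𝒪_w` is EXACTLY the conductor-`j` order.
* §1 `exists_valued_galAdicCompletionMap_sub_self_eq_sq_mul` — every `x ∈ L_w` has `|σx − x| = |q|²·D` for its `τ`-coordinate `q ∈ L⁺_v` (so σ-depths `≡ d (mod 2)`: NO ODD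
  STEPS `D·exp(−(2j+1))`, `valued_galAdicCompletionMap_sub_self_ne_mul_exp_odd`).
* §2 `valued_galAdicCompletionMap_sub_self_le_sq_mul_iff` — in coordinates `x = ι p + ι q τ`: `|σx − x| ≤ a²·D ↔ |q| ≤ a` (`a ∈ ℤᵐ⁰`).
* §3 **`valued_galAdicCompletionMap_sub_self_le_iff_mem_order`** — for `x ∈ 𝒪_w`, `j : ℕ`, `ϖ_v` a uniformiser of `L⁺_v`:
  `|σx − x| ≤ exp(−2j)·D ↔ ∃ a b ∈ 𝒪_v, x = ι a + ι (ϖ_v^j·b)·τ` — the σ-DEPTH-`(d+2j)` ball of `𝒪_w` IS the order `𝒪_v + ϖ_v^j 𝒪_w` (`ι 𝒪_v ⊕ ι ϖ_v^j 𝒪_v · τ` in the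
  Eisenstein basis ★ `toPlace_add_toPlace_mul_mem_integer_iff`); `j = 0` is ★ `valued_galAdicCompletionMap_sub_self_le_of_mem_integer`.
* §4 GROUP STRUCTURE of the σ-depth balls of units (ultrametric, no coordinates): `valued_galAdicCompletionMap_sub_self_mul_le` (`|σ(xy) − xy| ≤ max (|x|·|σy − y|) (|σx − x|·|y|)`),
  `valued_galAdicCompletionMap_sub_self_inv` (`|σ(x⁻¹) − x⁻¹| = |σx − x| ∕ |x|²`), so `{u : |u| = 1, |σu − u| ≤ c}` is closed under `*` and `⁻¹` (`…_mul_le_of_units`,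
  `…_inv_le_of_unit`) — the unit group of the conductor-`j` order for `c = exp(−2j)·D`, whose index `q_v^j` is the (tame ★ ∕ wild to-do) Mars index.

## References
* [Serre1979] J.-P. Serre, *Local Fields*, GTM 67 (1979): Ch. IV §1 (`i_G`, the filtration `σ x ≡ x mod 𝔭^{i+1}`), Ch. III §6.
* [NeukirchANT1999] J. Neukirch, *Algebraic Number Theory* (1999): Ch. I §12 (orders `𝒪 + 𝔣𝒪_K`, conductor).
* [Flicker1998UnitaryFL] Y. Z. Flicker, *Elementary proof of the fundamental lemma for a unitary group*, Canad. J. Math. 50 (1998), Prop. 7 p. 84 (the orders `R_E(j) = R + π^j R_E`).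
-/

set_option autoImplicit false

noncomputable section

open NumberField IsDedekindDomain ValuativeRel
open scoped ValuativeRel WithZero

namespace Literature.NumberTheory.Automorphic.UnitaryGroup

variable (L : Type) [Field L] [NumberField L] [IsCMField L] (v : HeightOneSpectrum (𝓞 ↥(maximalRealSubfield L)))
  (w : PlacesOver L v) (hw : IsCMField.complexConj L • w.1 = w.1) (he : v.asIdeal.ramificationIdx' w.1.asIdeal ≠ 1)

/-! ## §1 σ-depths are `|q|² · D`: no odd steps -/

include he in
/-- **Every `x ∈ L_w` has `|σx − x| = |q|² · |στ − τ|`** for its `τ`-coordinate `q` (`x = ι p + ι q τ`, ★ `exists_eq_toPlace_add_toPlace_mul`). [cite: Serre1979, Ch. IV §1] -/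
theorem exists_valued_galAdicCompletionMap_sub_self_eq_sq_mul {τ : w.1.adicCompletion L} (hτ : Valued.v τ = WithZero.exp (-1 : ℤ)) (x : w.1.adicCompletion L) :
    ∃ q : v.adicCompletion ↥(maximalRealSubfield L),
      Valued.v (galAdicCompletionMap (L := L) (IsCMField.complexConj L) hw x - x) =
        Valued.v q ^ 2 * Valued.v (galAdicCompletionMap (L := L) (IsCMField.complexConj L) hw τ - τ) := by
  obtain ⟨p, q, rfl⟩ := exists_eq_toPlace_add_toPlace_mul L v w hw he hτ x
  exact ⟨q, valued_galAdicCompletionMap_sub_self_toPlace_add_toPlace_mul L v w hw he τ p q⟩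

include he in
/-- **NO ODD STEPS**: `|σx − x|` is never `D · exp(−(2j+1))` (`D = |στ − τ|`) — the σ-depth filtration of `L_w` jumps only at `d + 2ℤ`.  (Tame `d = 1`: only odd TOTAL depths
`2j + 1`, cf. ★ `RamifiedQuadraticOrder.map_sub_self_mem_pow_succ_of_even`.) [cite: Serre1979, Ch. IV §1] -/
theorem valued_galAdicCompletionMap_sub_self_ne_mul_exp_odd {τ : w.1.adicCompletion L} (hτ : Valued.v τ = WithZero.exp (-1 : ℤ)) (x : w.1.adicCompletion L) (j : ℤ) :
    Valued.v (galAdicCompletionMap (L := L) (IsCMField.complexConj L) hw x - x) ≠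
      Valued.v (galAdicCompletionMap (L := L) (IsCMField.complexConj L) hw τ - τ) * WithZero.exp (-(2 * j + 1)) := by
  obtain ⟨q, hq⟩ := exists_valued_galAdicCompletionMap_sub_self_eq_sq_mul L v w hw he hτ x
  rw [hq]
  intro h
  have hD := valued_galAdicCompletionMap_sub_self_ne_zero L v w hw he hτ
  have h' : Valued.v q ^ 2 = WithZero.exp (-(2 * j + 1)) := by
    have := congrArg (· * (Valued.v (galAdicCompletionMap (L := L) (IsCMField.complexConj L) hw τ - τ))⁻¹) h
    simpa only [mul_inv_cancel_right₀ hD, mul_comm (Valued.v _) (WithZero.exp _)] using this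
  rcases eq_or_ne q 0 with hq0 | hq0
  · rw [hq0, map_zero, zero_pow two_ne_zero] at h'; exact WithZero.zero_ne_coe h'
  obtain ⟨m, hm⟩ : ∃ m : ℤ, Valued.v q = WithZero.exp m := ⟨_, (WithZero.exp_log ((Valuation.ne_zero_iff _).2 hq0)).symm⟩
  rw [hm, ← WithZero.exp_nsmul, WithZero.exp_inj] at h'
  simp only [nsmul_eq_mul, Nat.cast_ofNat] at h'
  omega

/-! ## §2 σ-depth in coordinates -/

/-- In `ℤᵐ⁰`: `x² ≤ a² ↔ x ≤ a`. [cite: Serre1979, Ch. II §1] -/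
theorem sq_le_sq_iff_withZero (x a : WithZero (Multiplicative ℤ)) : x ^ 2 ≤ a ^ 2 ↔ x ≤ a :=
  pow_le_pow_iff_left₀ zero_le zero_le two_ne_zero

include he in
/-- **σ-DEPTH IN COORDINATES**: for `x = ι p + ι q τ` and `a ∈ ℤᵐ⁰`, `|σx − x| ≤ a² · |στ − τ| ↔ |q| ≤ a`. [cite: Serre1979, Ch. IV §1] -/
theorem valued_galAdicCompletionMap_sub_self_le_sq_mul_iff {τ : w.1.adicCompletion L} (hτ : Valued.v τ = WithZero.exp (-1 : ℤ))
    (p q : v.adicCompletion ↥(maximalRealSubfield L)) (a : WithZero (Multiplicative ℤ)) :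
    Valued.v (galAdicCompletionMap (L := L) (IsCMField.complexConj L) hw (toPlace v w p + toPlace v w q * τ) - (toPlace v w p + toPlace v w q * τ)) ≤
        a ^ 2 * Valued.v (galAdicCompletionMap (L := L) (IsCMField.complexConj L) hw τ - τ) ↔
      Valued.v q ≤ a := by
  have hD := valued_galAdicCompletionMap_sub_self_ne_zero L v w hw he hτ
  rw [valued_galAdicCompletionMap_sub_self_toPlace_add_toPlace_mul L v w hw he τ p q, mul_le_mul_iff_of_pos_right (zero_lt_iff.2 hD), sq_le_sq_iff_withZero]

/-! ## §3 The σ-depth balls of `𝒪_w` are the conductor orders `𝒪_v + ϖ_v^j 𝒪_w` -/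

include he in
/-- **σ-DEPTH `d + 2j` ON `𝒪_w` = THE CONDUCTOR-`j` ORDER**: for `x ∈ 𝒪_w`, a uniformiser `ϖ_v` of `L⁺_v` and `j : ℕ`,
`|σx − x| ≤ exp(−2j) · |στ − τ| ↔ ∃ a b ∈ 𝒪_v, x = ι a + ι (ϖ_v^j · b) · τ`, i.e. `x ∈ 𝒪_v + ϖ_v^j 𝒪_w` (`= 𝒪_v ⊕ 𝒪_v ϖ_v^j τ` in the Eisenstein basis).  At a tame place
(`d = 1`) this is the order `{σu ≡ u (𝔪^{2j+1})}` of ★ `RamifiedQuadraticOrderUnitIndex`; Flicker's `R + π^j R_E`. [cite: NeukirchANT1999, Ch. I §12] [cite: Flicker1998UnitaryFL, Prop. 7 p. 84] [cite: Serre1979, Ch. IV §1] -/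
theorem valued_galAdicCompletionMap_sub_self_le_iff_mem_order {τ : w.1.adicCompletion L} (hτ : Valued.v τ = WithZero.exp (-1 : ℤ))
    {ϖF : v.adicCompletion ↥(maximalRealSubfield L)} (hϖF : Valued.v ϖF = WithZero.exp (-1 : ℤ)) (j : ℕ)
    {x : w.1.adicCompletion L} (hx : Valued.v x ≤ 1) :
    Valued.v (galAdicCompletionMap (L := L) (IsCMField.complexConj L) hw x - x) ≤
        WithZero.exp (-(2 * j : ℤ)) * Valued.v (galAdicCompletionMap (L := L) (IsCMField.complexConj L) hw τ - τ) ↔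
      ∃ a b : v.adicCompletion ↥(maximalRealSubfield L), Valued.v a ≤ 1 ∧ Valued.v b ≤ 1 ∧ x = toPlace v w a + toPlace v w (ϖF ^ j * b) * τ := by
  obtain ⟨p, q, rfl⟩ := exists_eq_toPlace_add_toPlace_mul L v w hw he hτ x
  obtain ⟨hp, hq⟩ := (toPlace_add_toPlace_mul_mem_integer_iff L v w hw he hτ p q).1 ((v_le_one_iff_mem_integer _).1 hx)
  have hexp : WithZero.exp (-(2 * j : ℤ)) = Valued.v ϖF ^ j * Valued.v ϖF ^ j := by
    rw [hϖF, ← pow_add, ← WithZero.exp_nsmul]; congr 1; simp only [nsmul_eq_mul]; push_cast; ring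
  have hϖ0 : ϖF ≠ 0 := fun h => by rw [h, map_zero] at hϖF; exact WithZero.zero_ne_coe hϖF
  have hϖj : Valued.v ϖF ^ j ≠ 0 := pow_ne_zero _ ((Valuation.ne_zero_iff _).2 hϖ0)
  rw [hexp, ← pow_two, valued_galAdicCompletionMap_sub_self_le_sq_mul_iff L v w hw he hτ p q]
  constructor
  · intro hqj
    -- `q = ϖ^j · b` with `b := q / ϖ^j ∈ 𝒪_v`
    refine ⟨p, q / ϖF ^ j, (v_le_one_iff_mem_integer p).2 hp, ?_, by rw [mul_div_cancel₀ _ (pow_ne_zero _ hϖ0)]⟩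
    rw [map_div₀, map_pow, div_le_one₀ (zero_lt_iff.2 hϖj)]; exact hqj
  · rintro ⟨a, b, -, hb, hab⟩
    -- uniqueness of coordinates: compare `τ`-coordinates via the valuation formula
    have hιinj : Function.Injective (toPlace v w) := (toPlace v w).injective
    have hq' : q = ϖF ^ j * b := by
      have h0 : toPlace v w (p - a) + toPlace v w (q - ϖF ^ j * b) * τ = 0 := by
        rw [map_sub, map_sub]; linear_combination hab
      have hval := valued_toPlace_add_toPlace_mul L v w hw he hτ (p - a) (q - ϖF ^ j * b)
      rw [h0, map_zero] at hval
      have h2 : Valued.v (q - ϖF ^ j * b) ^ 2 * WithZero.exp (-1 : ℤ) = 0 :=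
        le_antisymm (by rw [hval]; exact le_max_right _ _) zero_le
      rcases mul_eq_zero.1 h2 with h | h
      · exact sub_eq_zero.1 ((Valuation.zero_iff _).1 (pow_eq_zero_iff two_ne_zero |>.1 h))
      · exact absurd h WithZero.coe_ne_zero
    rw [hq', map_mul, map_pow]
    calc Valued.v ϖF ^ j * Valued.v b ≤ Valued.v ϖF ^ j * 1 := by gcongr
      _ = Valued.v ϖF ^ j := mul_one _

include he in
/-- The `j = 0` step: `|σx − x| ≤ |στ − τ|` on all of `𝒪_w` (= ★ `valued_galAdicCompletionMap_sub_self_le_of_mem_integer`, restated in the §3 shape). [cite: Serre1979, Ch. IV §1] -/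
theorem valued_galAdicCompletionMap_sub_self_le_of_mem_integer' {τ : w.1.adicCompletion L} (hτ : Valued.v τ = WithZero.exp (-1 : ℤ))
    {x : w.1.adicCompletion L} (hx : Valued.v x ≤ 1) :
    Valued.v (galAdicCompletionMap (L := L) (IsCMField.complexConj L) hw x - x) ≤
      WithZero.exp (-(2 * (0 : ℕ) : ℤ)) * Valued.v (galAdicCompletionMap (L := L) (IsCMField.complexConj L) hw τ - τ) := by
  rw [Nat.cast_zero, mul_zero, neg_zero, WithZero.exp_zero, one_mul]
  exact valued_galAdicCompletionMap_sub_self_le_of_mem_integer L v w hw he hτ hx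

/-! ## §4 The σ-depth balls of units are groups (ultrametric, coordinate-free) -/

/-- **`|σ(xy) − xy| ≤ max (|x|·|σy − y|) (|σx − x|·|y|)`** (`σ(xy) − xy = σx·(σy − y) + (σx − x)·y`, `|σx| = |x|`). [cite: Serre1979, Ch. IV §1] -/
theorem valued_galAdicCompletionMap_sub_self_mul_le (x y : w.1.adicCompletion L) :
    Valued.v (galAdicCompletionMap (L := L) (IsCMField.complexConj L) hw (x * y) - x * y) ≤
      max (Valued.v x * Valued.v (galAdicCompletionMap (L := L) (IsCMField.complexConj L) hw y - y))
          (Valued.v (galAdicCompletionMap (L := L) (IsCMField.complexConj L) hw x - x) * Valued.v y) := by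
  have h : galAdicCompletionMap (L := L) (IsCMField.complexConj L) hw (x * y) - x * y =
      galAdicCompletionMap (L := L) (IsCMField.complexConj L) hw x * (galAdicCompletionMap (L := L) (IsCMField.complexConj L) hw y - y) +
        (galAdicCompletionMap (L := L) (IsCMField.complexConj L) hw x - x) * y := by
    rw [map_mul]; ring
  rw [h]
  refine (Valuation.map_add _ _ _).trans ?_
  rw [map_mul, map_mul, valued_galAdicCompletionMap]

/-- **`|σ(x⁻¹) − x⁻¹| · |x|² = |σx − x|`** (`σ(x⁻¹) − x⁻¹ = −(σx − x) ∕ (x·σx)`). [cite: Serre1979, Ch. IV §1] -/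
theorem valued_galAdicCompletionMap_sub_self_inv (x : w.1.adicCompletion L) (hx : x ≠ 0) :
    Valued.v (galAdicCompletionMap (L := L) (IsCMField.complexConj L) hw x⁻¹ - x⁻¹) * Valued.v x ^ 2 =
      Valued.v (galAdicCompletionMap (L := L) (IsCMField.complexConj L) hw x - x) := by
  have hσx : galAdicCompletionMap (L := L) (IsCMField.complexConj L) hw x ≠ 0 := (_root_.map_ne_zero _).2 hx
  have h : galAdicCompletionMap (L := L) (IsCMField.complexConj L) hw x⁻¹ - x⁻¹ =
      -(galAdicCompletionMap (L := L) (IsCMField.complexConj L) hw x - x) * (x * galAdicCompletionMap (L := L) (IsCMField.complexConj L) hw x)⁻¹ := by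
    rw [map_inv₀]; field_simp; ring
  rw [h, map_mul, Valuation.map_neg, map_inv₀, map_mul, valued_galAdicCompletionMap, ← pow_two, inv_mul_cancel_right₀ (pow_ne_zero _ ((Valuation.ne_zero_iff _).2 hx))]

/-- **UNITS OF σ-DEPTH `≤ c` ARE CLOSED UNDER MULTIPLICATION.** [cite: Serre1979, Ch. IV §1] [cite: NeukirchANT1999, Ch. I §12] -/
theorem valued_galAdicCompletionMap_sub_self_mul_le_of_units {x y : w.1.adicCompletion L} (hx : Valued.v x = 1) (hy : Valued.v y = 1) {c : WithZero (Multiplicative ℤ)}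
    (hxc : Valued.v (galAdicCompletionMap (L := L) (IsCMField.complexConj L) hw x - x) ≤ c)
    (hyc : Valued.v (galAdicCompletionMap (L := L) (IsCMField.complexConj L) hw y - y) ≤ c) :
    Valued.v (galAdicCompletionMap (L := L) (IsCMField.complexConj L) hw (x * y) - x * y) ≤ c := by
  refine (valued_galAdicCompletionMap_sub_self_mul_le L v w hw x y).trans (max_le ?_ ?_)
  · rw [hx, one_mul]; exact hyc
  · rw [hy, mul_one]; exact hxc

/-- **UNITS OF σ-DEPTH `≤ c` ARE CLOSED UNDER INVERSION.** [cite: Serre1979, Ch. IV §1] [cite: NeukirchANT1999, Ch. I §12] -/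
theorem valued_galAdicCompletionMap_sub_self_inv_le_of_unit {x : w.1.adicCompletion L} (hx : Valued.v x = 1) {c : WithZero (Multiplicative ℤ)}
    (hxc : Valued.v (galAdicCompletionMap (L := L) (IsCMField.complexConj L) hw x - x) ≤ c) :
    Valued.v (galAdicCompletionMap (L := L) (IsCMField.complexConj L) hw x⁻¹ - x⁻¹) ≤ c := by
  have hx0 : x ≠ 0 := fun h => by rw [h, map_zero] at hx; exact zero_ne_one hx
  have h := valued_galAdicCompletionMap_sub_self_inv L v w hw x hx0
  rw [hx, one_pow, mul_one] at h
  rw [h]; exact hxc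

end Literature.NumberTheory.Automorphic.UnitaryGroup

end
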